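import Literature.AnabelianGeometry.EtaleTheta.TemperedFrobenioidHull

/-!
# [EtTh] §3, part 4: Remarks 3.6.1–3.6.6, Theorem 3.7, Remarks 3.7.1–3.7.2, Corollary 3.8,
# Remarks 3.8.1–3.8.2

Source: [MochizukiEtTh2009] §3, PDF pp. 78–82 (printed 304–308). Locators `p.N` = PDF page.

Theorem 3.7 and Corollary 3.8 are statements about the Frobenioid `C` of a tempered Frobenioid — the
CATEGORY `TemperedFrobenioid.category` of `TemperedFrobenioidModel.lean` with its pre-Frobenioid
structure `toElem : C → F_Φ` — in the vocabulary of [FrdI] Definitions 1.2–1.3 / §§2–5 and [FrdII] §0.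
The [FrdI] Def 1.2 part of that vocabulary is the tree's (`Frobenioids.PreFrobenioid.*`: isotropic /
unit-trivial / sub-quasi-Frobenius-trivial / group-like types, pre-steps, `O^×`, …) and is used as such;
what is not yet in the tree ("of unit-profinite / model / birationally Frobenius-normalized / standard /
rationally standard type" — [FrdI] Def 2.8, 4.5, 3.1; "Frobenius-slim", "Div-slim" — [FrdI] §4; the
isomorphism `Ψ^Φ` of [FrdI] Thm 4.9; (in)dissectible types — [FrdII] §0) is carried by ONE hypothesis
VOCABULARY `FrobenioidFacade D` whose fields are predicates on all pre-Frobenioids over `D` (fixed once,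
applied to `C₀.toElem`; TODO-merge markers name the owner seat); the hull `C^{bs-fld} → C` is the REAL
`hullCategory` / `hull` of `TemperedFrobenioidHull.lean`; `IsOfFSMFFType`, `IsSlim`, `IsMonoprime`, the §0 saturation
notions and the data of Def 3.6 are the tree's / this directory's. Remarks that are
commentary are module-doc paragraphs; Remarks with a claim are named `Prop`s.
-/

namespace Literature.AnabelianGeometry.EtaleTheta

open CategoryTheory Opposite Literature.AlgebraicGeometry.Frobenioids

universe u₀ v₀ u v w

variable {D₀ : Type u₀} [Category.{v₀} D₀] {V : FrdIMonoidStub.{w}}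
  {T : RealifiedDivisorMonoids (D₀ := D₀) V} {D : Type u} [Category.{v} D] {VD : FrdICatStub.{u, v, w} D}

namespace TemperedFrobenioid

variable (C₀ : TemperedFrobenioid T D VD)

/-- **Definition 3.6 (iv)** (p.78) on morphisms: "a morphism of the Frobenioid `C` [is]
*base-field-theoretic* if its zero divisor belongs to `Φ^{bs-fld}(-) ⊆ Φ(-)`".
[cite: MochizukiEtTh2009, Def 3.6 p.78] -/
def IsBaseFieldTheoretic : MorphismProperty C₀.category := fun _ _ φ =>
  C₀.IsBaseFieldTheoreticDiv (ModelFrobenioid.div φ)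

/-- **Definition 3.6 (iii)** (p.77) on morphisms: "a pre-step of `C` [is] *non-cuspidal* … if its zero
divisor is non-cuspidal" (pre-steps via the tree's [FrdI] Def 1.2 (iii)). [cite: MochizukiEtTh2009, Def 3.6 p.77] -/
def IsNonCuspidalPreStep : MorphismProperty C₀.category := fun _ _ φ =>
  PreFrobenioid.IsPreStep C₀.toElem φ ∧ C₀.IsNonCuspidal (ModelFrobenioid.div φ)

/-- **Definition 3.6 (iii)** (p.77): "… (respectively, *cuspidal*) if its zero divisor is … cuspidal".
[cite: MochizukiEtTh2009, Def 3.6 p.77] -/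
def IsCuspidalPreStep : MorphismProperty C₀.category := fun _ _ φ =>
  PreFrobenioid.IsPreStep C₀.toElem φ ∧ C₀.IsCuspidal (ModelFrobenioid.div φ)

end TemperedFrobenioid

/-- The [FrdI]/[FrdII] notions about Frobenioids that Theorem 3.7 mentions and that are not yet in the
tree, as a hypothesis VOCABULARY: each field is a PREDICATE on all pre-Frobenioids `C → F_Φ` over the
base category `D` (so that it is fixed once for `D` and merely APPLIED to `C₀.toElem`; merge pass =
instantiate with the [FrdI] definitions when they land — TODO-merge(abc-iut-L1-t2, abc-iut-L1-t3)).
[cite: MochizukiEtTh2009, Thm 3.7 p.79] -/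
structure FrobenioidFacade (D : Type u) [Category.{v} D] : Type (max u v w + 1) where
  /-- [FrdI] Def 2.8 (ii) (kurims p.53): "of unit-profinite type" (every `O^×(A)` admits a topologically
  finitely generated profinite topology — tree `Frobenioids.AdmitsTfgProfiniteTopology`) -/
  IsOfUnitProfiniteType : ∀ {Φ : Dᵒᵖ ⥤ CommMonCat.{w}} {C : Type (max u w)} [Category.{max v w} C],
    (C ⥤ ElemFrobenioid Φ) → Prop
  /-- [FrdI] Def 4.5 (i): "of model type" -/
  IsOfModelType : ∀ {Φ : Dᵒᵖ ⥤ CommMonCat.{w}} {C : Type (max u w)} [Category.{max v w} C],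
    (C ⥤ ElemFrobenioid Φ) → Prop
  /-- [FrdI] Def 4.5 (i): "of birationally Frobenius-normalized type" -/
  IsOfBiratFrobeniusNormalizedType : ∀ {Φ : Dᵒᵖ ⥤ CommMonCat.{w}} {C : Type (max u w)}
    [Category.{max v w} C], (C ⥤ ElemFrobenioid Φ) → Prop
  /-- [FrdI] Def 3.1 (i): "of standard type" -/
  IsOfStandardType : ∀ {Φ : Dᵒᵖ ⥤ CommMonCat.{w}} {C : Type (max u w)} [Category.{max v w} C],
    (C ⥤ ElemFrobenioid Φ) → Prop
  /-- [FrdI] Def 4.5 (iii): "of rationally standard type" -/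
  IsOfRationallyStandardType : ∀ {Φ : Dᵒᵖ ⥤ CommMonCat.{w}} {C : Type (max u w)} [Category.{max v w} C],
    (C ⥤ ElemFrobenioid Φ) → Prop
  /-- (Thm 3.7 (iii)) "the natural action of `Aut_C(A)` on `O^▷(A)` and `O^×(A)` factors through
  `Aut_{D^cnst}(A^cnst)`" — `D^cnst`, `A^cnst` being the image data of `D₀ → D^cnst = B(Spec K)⁰` (p.72);
  TODO-merge(abc-iut-L3-t2 / abc-iut-L1-t4) -/
  AutActionFactorsThroughCnst : ∀ {Φ : Dᵒᵖ ⥤ CommMonCat.{w}} {C : Type (max u w)} [Category.{max v w} C],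
    (C ⥤ ElemFrobenioid Φ) → C → Prop
  /-- (Thm 3.7 (iii), second clause) the induced action of the image of `Aut_C(A)` in
  `Aut_{D^cnst}(A^cnst)` on `O^▷(A)`, `O^×(A)` is faithful -/
  AutActionFaithfulCnst : ∀ {Φ : Dᵒᵖ ⥤ CommMonCat.{w}} {C : Type (max u w)} [Category.{max v w} C],
    (C ⥤ ElemFrobenioid Φ) → C → Prop

/-! ## Remarks 3.6.1–3.6.6 (pp.78–79) -/

/-! Remark 3.6.1 (p.78): "the group-saturated-ness hypothesis of Definition 3.6, (ii), may be regarded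
as the condition that 'divisors relative to `Φ` are effective if and only if they are effective relative
to `Φ^{ℝ-log}`' … [or] as the analogue in the present 'tempered context' of the monoprime-ness hypothesis
in [FrdII], Example 1.1, (ii) — cf. Remark 3.5.1." Interpretation; the first reading is literally
`isGroupSaturated_iff'` of `Conventions.lean`. No further declaration. -/

namespace TemperedFrobenioid

variable (C₀ : TemperedFrobenioid T D VD)

/-- **Remark 3.6.2** (p.78), second claim: "`Φ^{bs-fld}` is always non-dilating and strictly rational"
(strict rationality via the vocabulary `VD`; non-dilating via `V` on the endomorphisms induced by
endomorphisms of objects). The first claims ("the base-field-theoretic hull … is itself a tempered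
Frobenioid", "every `p`-adic Frobenioid may be obtained in this way") concern the hull as a tempered
Frobenioid / [FrdII] Ex 1.1 and are TODO-merge(abc-iut-L1-t4). Named `Prop`.
[cite: MochizukiEtTh2009, Rmk 3.6.2 p.78] -/
def Remark362 : Prop :=
  VD.IsStrictlyRational C₀.bsFldMonoid ∧
    ∀ (A : Dᵒᵖ) (f : A ⟶ A), V.IsNonDilating (C₀.bsFld.carrier A) (C₀.bsFld.pull f)

/-- **Remark 3.6.3** (pp.78–79): the essential image of `C^{bs-fld} → C` consists of "the objects of `C`
that may be 'linked' to a Frobenius-trivial object via base-field theoretic pre-steps" and "the base-field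
theoretic morphisms of `C` between objects of the essential image"; "In particular, the natural functor
`C^{bs-fld} → C` is isomorphism-full [cf. §0]." Rendered by the last clause (§0 `IsIsomorphismFull`) and
the morphism clause (§0 `essImageHom` = base-field-theoretic morphisms between essential-image objects).
Named `Prop` about the REAL functor `C₀.hull : C₀.hullCategory ⥤ C₀.category`
(`TemperedFrobenioidHull.lean`). [cite: MochizukiEtTh2009, Rmk 3.6.3 p.79] -/
def Remark363 : Prop :=
  IsIsomorphismFull C₀.hull ∧
    ∀ {A B : C₀.category} (f : A ⟶ B), essImageObj C₀.hull A → essImageObj C₀.hull B →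
      (essImageHom C₀.hull f ↔ C₀.IsBaseFieldTheoretic f)

/-! Remark 3.6.4 (p.79): "it follows from Lemma 3.5 [applied to the submonoid `Φ ⊆ Φ^{ℝ-log}`] that the
respective divisor monoids `Φ^pf`, `Φ^rlf` of `C^pf`, `C^rlf` also satisfy the conditions of Definition
3.6, (ii). That is to say, the perfection and realification of a tempered Frobenioid are again tempered
Frobenioids." The perfection `C^pf` / realification `C^rlf` of a Frobenioid are [FrdI] Prop 5.3
(TODO-merge(abc-iut-L1-t2)); with `Φ` a `SubMonoidOn Φ^{ℝ-log}` the content is: the perf- and group-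
saturations of `Φ(A)` in `Φ^{ℝ-log}(A)` (§0) again satisfy Def 3.6 (ii) — recorded in `Remark364` below
for the perfection (the realification needs `V.IsRealification` data and is left to the merge pass).
Remark 3.6.5 (p.79): "the operations of perfection and realification are compatible with the operation
of passing to the associated base-field-theoretic hull" — commentary on 3.6.4, no declaration. -/

/-- **Remark 3.6.4** (p.79), perfection clause, as a named `Prop`: the perf-saturation of `Φ` in
`Φ^{ℝ-log}` is again group-saturated, perf-factorial and has monoprime base-field part (the conditions of
Def 3.6 (ii) that do not involve `B`). [cite: MochizukiEtTh2009, Rmk 3.6.4 p.79] -/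
def Remark364 : Prop :=
  ∀ A : Dᵒᵖ, IsGroupSaturated (perfSaturation (C₀.Φ.carrier A)) ∧
    V.IsPerfFactorial (perfSaturation (C₀.Φ.carrier A)) ∧
    IsMonoprime ↥(perfSaturation (C₀.Φ.carrier A) ⊓
      (T.cnstR (C₀.baseOp A)).toSubmonoid.comap Algebra.GrothendieckGroup.of)

/-! Remark 3.6.6 (p.79): "if one supposes further that `Φ` is perfect, then condition (a) follows from
condition (b) [or, alternatively, from the condition that `Φ^{bs-fld}(A)` be nonzero for each
`A ∈ Ob(D)`]. Indeed, this follows immediately by applying the factorization homomorphism of [FrdI],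
Definition 2.4, (i), (c)". A remark on the redundancy of field `isMonoprime_bsFld` of
`TemperedFrobenioid` when `Φ` is perfect; it needs the factorization homomorphism ([FrdI] Def 2.4,
TODO-merge(abc-iut-L1-t2)) and is not given a declaration. -/

/-! ## Theorem 3.7 (pp.79–80) "Basic Properties of Tempered Frobenioids" -/

/-- **Theorem 3.7 (i)** (p.79): "If `Λ = ℤ` (respectively, `Λ = ℝ`), then `C` is of unit-profinite
(respectively, unit-trivial) type. For arbitrary `Λ`, the Frobenioid `C` is of isotropic, model [hence,
in particular, birationally Frobenius-normalized], and sub-quasi-Frobenius-trivial type, but not of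
group-like type." Named `Prop`; "unit-trivial / isotropic / sub-quasi-Frobenius-trivial / group-like type"
are the tree's [FrdI] Def 1.2 (v) predicates on `C = C₀.category`, the others vocabulary predicates
applied to `C₀.toElem`. [cite: MochizukiEtTh2009, Thm 3.7 p.79] -/
def Thm37_i (F : FrobenioidFacade.{u, v, w} D) : Prop :=
  (C₀.monoidType = MonoidType.Z → F.IsOfUnitProfiniteType C₀.toElem) ∧
  (C₀.monoidType = MonoidType.R → PreFrobenioid.IsOfType (PreFrobenioid.IsUnitTrivial C₀.toElem)) ∧
  PreFrobenioid.IsOfIsotropicType C₀.toElem ∧ F.IsOfModelType C₀.toElem ∧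
  F.IsOfBiratFrobeniusNormalizedType C₀.toElem ∧
  PreFrobenioid.IsOfType (PreFrobenioid.IsSubQuasiFrobeniusTrivial C₀.toElem) ∧
  ¬ PreFrobenioid.IsOfType (PreFrobenioid.IsGroupLikeObj C₀.toElem)

/-- **Theorem 3.7 (ii)** (p.79): "Suppose `D` is of FSMFF-type, and that `Φ` is non-dilating. Then `C` is
of standard type. If, moreover, `Φ` is rational [cf. Definition 3.6, (ii)], then `C` is of rationally
standard type." (`IsOfFSMFFType` is the tree's; non-dilating via `V` on induced endomorphisms.)
[cite: MochizukiEtTh2009, Thm 3.7 p.79] -/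
def Thm37_ii (F : FrobenioidFacade.{u, v, w} D) : Prop :=
  IsOfFSMFFType D → (∀ (A : Dᵒᵖ) (f : A ⟶ A), V.IsNonDilating (C₀.Φ.carrier A) (C₀.Φ.pull f)) →
    F.IsOfStandardType C₀.toElem ∧ (C₀.IsRational → F.IsOfRationallyStandardType C₀.toElem)

/-- **Theorem 3.7 (iii)** (pp.79–80): "Let `A ∈ Ob(C)`; `A_D := Base(A) ∈ Ob(D)`. Write
`A^cnst ∈ Ob(D^cnst)` for the image of `A_D` in `D^cnst`. Then the natural action of `Aut_C(A)` on
`O^▷(A)` and `O^×(A)` factors through `Aut_{D^cnst}(A^cnst)`. If, moreover, `Λ ∈ {ℤ, ℚ}`, then this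
factorization determines a faithful action of the image of `Aut_C(A)` in `Aut_{D^cnst}(A^cnst)` on
`O^▷(A)`, `O^×(A)`." Named `Prop`; both clauses are vocabulary predicates (the functor `D₀ → D^cnst` is
[FrdII] Ex 1.3 material). [cite: MochizukiEtTh2009, Thm 3.7 p.79] -/
def Thm37_iii (F : FrobenioidFacade.{u, v, w} D) : Prop :=
  (∀ A : C₀.category, F.AutActionFactorsThroughCnst C₀.toElem A) ∧
    (C₀.monoidType = MonoidType.Z ∨ C₀.monoidType = MonoidType.Q →
      ∀ A : C₀.category, F.AutActionFaithfulCnst C₀.toElem A)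

/-- **Theorem 3.7 (iv)** (p.80): "If `D` is slim [cf. [FrdI], §0], and `Λ ∈ {ℤ, ℝ}`, then `C` is also
slim." (`IsSlim` is the tree's, for both `D` and `C = C₀.category`; no facade needed.)
[cite: MochizukiEtTh2009, Thm 3.7 p.80] -/
def Thm37_iv : Prop :=
  IsSlim D → (C₀.monoidType = MonoidType.Z ∨ C₀.monoidType = MonoidType.R) → IsSlim C₀.category

/-! Remark 3.7.1 (p.80): "if `D` is of weakly indissectible (respectively, strongly dissectible; weakly
dissectible) type, then so is `C`" [cf. [FrdII], §0] — the (in)dissectibility types are [FrdII] §0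
(seat abc-iut-L1-t4, `Dissection.lean` staged); to be stated in the merge pass (no declaration here). -/

/-- **Remark 3.7.2** (p.80): "`D₀` is slim [cf. [SemiAnbd], Example 3.10; Remark 3.4.1] and of FSM-,
hence also of FSMFF-, type [cf. [FrdII], Example 1.3, (i)]." A FACT about the connected temperoid
`D₀ = B^temp(X^log)⁰`; as `D₀` is abstract here it is recorded as a named `Prop` (tree vocabulary).
[cite: MochizukiEtTh2009, Rmk 3.7.2 p.80] -/
def Remark372 (D₀ : Type u₀) [Category.{v₀} D₀] : Prop :=
  IsSlim D₀ ∧ IsOfFSMType D₀ ∧ IsOfFSMFFType D₀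

end TemperedFrobenioid

/-! ## Corollary 3.8 (pp.80–81) "Preservation of Base-field-theoretic Morphisms and Hulls" -/

section Corollary38

variable {D₀' : Type u₀} [Category.{v₀} D₀'] {T' : RealifiedDivisorMonoids (D₀ := D₀') V}
  {D' : Type u} [Category.{v} D'] {VD' : FrdICatStub.{u, v, w} D'}
  (C₁ : TemperedFrobenioid T D VD) (C₂ : TemperedFrobenioid T' D' VD')

/-- The standing hypotheses of **Corollary 3.8** (p.80): "for `i = 1, 2`, `C_i` is a tempered Frobenioid
whose base category `D_i` is of FSMFF-type, and whose divisor monoid `Φ_i` is non-dilating. Let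
`Ψ : C₁ ≅ C₂` be an equivalence of categories." (The extra hypotheses of (i)/(ii), "`D_i` Frobenius-slim" /
"`D_i` Div-slim [relative to `Φ_i`]" ([FrdI] §4, TODO-merge(abc-iut-L1-t3)), enter those statements as
vocabulary predicates on base categories.) [cite: MochizukiEtTh2009, Cor 3.8 p.80] -/
structure Cor38Hyp where
  /-- `Ψ : C₁ ≅ C₂` -/
  Ψ : C₁.category ≌ C₂.category
  /-- `D₁`, `D₂` of FSMFF-type -/
  fsmff : IsOfFSMFFType D ∧ IsOfFSMFFType D'
  /-- `Φ₁`, `Φ₂` non-dilating -/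
  nonDilating : (∀ (A : Dᵒᵖ) (f : A ⟶ A), V.IsNonDilating (C₁.Φ.carrier A) (C₁.Φ.pull f)) ∧
    ∀ (A : D'ᵒᵖ) (f : A ⟶ A), V.IsNonDilating (C₂.Φ.carrier A) (C₂.Φ.pull f)

variable {C₁ C₂}

/-- "`Ψ` preserves the base-field-theoretic morphisms" (Cor 3.8 (i)–(iii)).
[cite: MochizukiEtTh2009, Cor 3.8 p.80] -/
def PreservesBaseFieldTheoretic (h : Cor38Hyp C₁ C₂) : Prop :=
  ∀ {A B : C₁.category} (f : A ⟶ B),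
    C₁.IsBaseFieldTheoretic f ↔ C₂.IsBaseFieldTheoretic (h.Ψ.functor.map f)

/-- **Corollary 3.8 (i)** (p.80): "Suppose … the base category `D_i` of `C_i` is Frobenius-slim. Then `Ψ`
preserves the base-field-theoretic morphisms." `IsFrobeniusSlim` is the [FrdI] §4 predicate on categories
(vocabulary, quantified over all base categories; TODO-merge(abc-iut-L1-t3)). Named `Prop`.
[cite: MochizukiEtTh2009, Cor 3.8 p.80] -/
def Cor38_i (IsFrobeniusSlim : ∀ (E : Type u) [Category.{v} E], Prop) (h : Cor38Hyp C₁ C₂) : Prop :=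
  IsFrobeniusSlim D → IsFrobeniusSlim D' → PreservesBaseFieldTheoretic h

/-- **Corollary 3.8 (ii)** (pp.80–81): "Suppose … `D_i` … is Div-slim [relative to `Φ_i`]. Then `Ψ`
preserves the base-field-theoretic morphisms and induces a compatible equivalence
`C₁^{bs-fld} ≅ C₂^{bs-fld}` of the subcategories … given by the respective base-field-theoretic hulls."
`IsDivSlim` is the [FrdI] §4 predicate (vocabulary); the hulls and the functors `C_i^{bs-fld} → C_i` are the
REAL `hullCategory` / `hull` of `TemperedFrobenioidHull.lean`. Named `Prop`.
[cite: MochizukiEtTh2009, Cor 3.8 p.81] -/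
def Cor38_ii (IsDivSlim : ∀ (E : Type u) [Category.{v} E], (Eᵒᵖ ⥤ CommMonCat.{w}) → Prop)
    (h : Cor38Hyp C₁ C₂) : Prop :=
  IsDivSlim D C₁.divisorMonoid → IsDivSlim D' C₂.divisorMonoid →
    PreservesBaseFieldTheoretic h ∧
      ∃ Ψbs : C₁.hullCategory ≌ C₂.hullCategory,
        Nonempty (C₁.hull ⋙ h.Ψ.functor ≅ Ψbs.functor ⋙ C₂.hull)

/-- **Corollary 3.8 (iii)** (p.81): "Suppose that `Ψ` preserves the base-field-theoretic morphisms, and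
that `Φ₁`, `Φ₂` are cuspidally pure. Then `Ψ` preserves the non-cuspidal and cuspidal pre-steps. If,
moreover, `Φ₁`, `Φ₂` are rational, then the induced isomorphism of divisor monoids
`Ψ^Φ : Φ₁|_{C₁} ≅ Φ₂|_{C₂}` [lying over `Ψ`] of [FrdI], Theorem 4.9, preserves non-cuspidal elements and
primes, as well as cuspidal elements and primes." Rendered by the pre-step clause; the `Ψ^Φ` clause
needs [FrdI] Thm 4.9 (TODO-merge(abc-iut-L1-t3)). Named `Prop`. [cite: MochizukiEtTh2009, Cor 3.8 p.81] -/
def Cor38_iii (h : Cor38Hyp C₁ C₂) : Prop :=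
  PreservesBaseFieldTheoretic h → C₁.IsCuspidallyPure → C₂.IsCuspidallyPure →
    ∀ {A B : C₁.category} (f : A ⟶ B),
      (C₁.IsNonCuspidalPreStep f ↔ C₂.IsNonCuspidalPreStep (h.Ψ.functor.map f)) ∧
      (C₁.IsCuspidalPreStep f ↔ C₂.IsCuspidalPreStep (h.Ψ.functor.map f))

end Corollary38

/-! ### Remarks 3.8.1, 3.8.2 (p.82) — documentation
3.8.1: "in the situation of Corollary 3.8, (ii), for suitable base categories [i.e., of the sort that
appear in [FrdII], Theorem 2.4] one may apply to the equivalence `C₁^{bs-fld} ≅ C₂^{bs-fld}` induced by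
`Ψ` the theory of the category-theoreticity of the Kummer and reciprocity maps, as discussed in [FrdII],
Theorem 2.4." 3.8.2: under the hypotheses of Cor 3.8 (iii) with `Φ_i` rational, "by considering zero
divisors of base-field-theoretic pre-steps …, we obtain, for `i = 1, 2`, natural isomorphisms
`(ℝ_{≥0} ≅) Φ_i(C_i)^rlf_{𝔭_i} ≅ Φ_i(C_i)^rlf_{𝔮_i} (≅ ℝ_{≥0})` … compatible with the isomorphism
`Φ₁(C₁) ≅ Φ₂(C₂)` induced by `Ψ^Φ`", for non-cuspidal primes `𝔭_i, 𝔮_i` corresponding under `Ψ`.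
Both need [FrdII] Thm 2.4 / [FrdI] Thm 4.9 and the realified primary components ([FrdI] Def 2.4);
no declaration is made here (merge pass). -/

end Literature.AnabelianGeometry.EtaleTheta
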